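import Summits.HodgeConjecture.CorCM.Census.QuarticTwistSquares

/-!
# The quartic twist `(ℤ/4 × B, (2,0))`, III: the AFFINE REDUCTION — modulo the translates of any covering family of squares every
# type is an affine combination of atoms of its regime (`|B|` odd)

COR-CM (cell `pub-hodgecm2`), count-neutral kernel combinatorics by the binder seat b09 (gen 32; lane QUARTIC-TWIST), part III, sequel of
`Census/QuarticTwistSquares.lean`.  Theorems + two bookkeeping definitions (`affine`, `Covers`); no `decide` table, no certificate, no named
fact, no geometry, no `sorry`.  HONEST FRAMING: `HC_CM` is NOT proved; nothing here is a headline or a period.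

THE REDUCTION (`|B|` odd, `≥ 3`).  Call a type RESIDUAL if it is an atom `u + k·δ_b` (`IsRes`; `k = 0` gives the constant types).  Say a
submodule `N` COVERS if through every non-residual type `s` it contains the class of a cross square (`(s; p, q)`, `p, q` in different
columns) whose three other corners have smaller Lee potential (`Covers`).  For a regime `u` put
`affine u s = Σ_b e_{u + (s b − u)·δ_b} − (|B| − 1)·e_u` — the atoms of `s` seen from `u`, corrected so that the total mass is `1`.
* §1 `affine` is ADDITIVE in the columns: for two moves in different columns the square combination of the four `affine`'s vanishes
  (`affine_square`); on a residual type of regime `u` it is the unit vector (`affine_atom`); atoms have the expected regime when `|B| ≥ 3`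
  (`reg_atom`).
* §2 **`single_sub_affine_mem`**: if `N` covers then `e_s − affine (reg s) s ∈ N` for EVERY type `s` — induction on `Φ`: the covering
  square through `s` moves two columns toward the regime (part II `reg_move`), its corners keep the regime, and the square relation
  telescopes against the additivity of `affine`.
* §3 **`exists_reduced`**: if moreover `N` contains the column faces at the constant types (`[u] − [u+δ_b] − [u−δ_b] + [u+2δ_b]`, which
  kill the `2`-atoms), every exponent vector is congruent modulo `N` to one supported on the SMALL residual types `u`, `u ± δ_b`
  (`IsRes1`).  No choice of representatives, no orbit structure and no parity of `|B|` beyond oddness enters.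
All [folklore].

## References
* [Pohlmann1968] H. Pohlmann, Algebraic cycles on abelian varieties of complex multiplication type, Ann. of Math. 88 (1968), Thm 1.
-/

namespace Summit.HodgeConjecture.CorCM.Census.QuarticTwist

open Finset

variable (B : Type) [AddGroup B] [Fintype B] [DecidableEq B]

/-! ## §1 Residual types and the affine form -/

/-- A RESIDUAL type: an atom `u + k·δ_b` (constant types included, `k = 0`). [folklore] -/
def IsRes (s : Ty B) : Prop := ∃ (u : ZMod 4) (b : B) (k : ZMod 4), s = atom B u b k

/-- A SMALL residual type: `u`, `u + δ_b` or `u − δ_b`. [folklore] -/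
def IsRes1 (s : Ty B) : Prop := ∃ (u : ZMod 4) (b : B) (k : ZMod 4), (k = 0 ∨ k = 1 ∨ k = -1) ∧ s = atom B u b k

/-- The atom of `s` at the column `b` seen from the regime `u`, as a unit vector. [folklore] -/
def atomVec (u : ZMod 4) (s : Ty B) (b : B) : Ty B → ℤ := Pi.single (atom B u b (s b - u)) 1

/-- **The affine form** of `s` in the regime `u`: `Σ_b e_{u + (s b − u)·δ_b} − (|B| − 1)·e_u`. [folklore] -/
def affine (u : ZMod 4) (s : Ty B) : Ty B → ℤ :=
  ∑ b, atomVec B u s b - ((Fintype.card B : ℤ) - 1) • Pi.single (cst B u) 1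

omit [AddGroup B] in
/-- The atom vector at `b` depends only on `s b`. [folklore] -/
theorem atomVec_congr (u : ZMod 4) {s s' : Ty B} {b : B} (h : s b = s' b) : atomVec B u s b = atomVec B u s' b := by
  unfold atomVec; rw [h]

omit [AddGroup B] in
/-- **Additivity of the affine form over a cross square**: for columns `b₁ ≠ b₂` and any values `k₁, k₂`,
`affine u s − affine u (s + k₁δ_{b₁}) − affine u (s + k₂δ_{b₂}) + affine u (s + k₁δ_{b₁} + k₂δ_{b₂}) = 0`. [folklore] -/
theorem affine_square (u : ZMod 4) (s : Ty B) {b₁ b₂ : B} (hb : b₁ ≠ b₂) (k₁ k₂ : ZMod 4) :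
    affine B u s - affine B u (s + Pi.single b₁ k₁) - affine B u (s + Pi.single b₂ k₂)
      + affine B u (s + Pi.single b₁ k₁ + Pi.single b₂ k₂) = 0 := by
  unfold affine
  have hsum : ∑ b, atomVec B u s b - ∑ b, atomVec B u (s + Pi.single b₁ k₁) b - ∑ b, atomVec B u (s + Pi.single b₂ k₂) b
      + ∑ b, atomVec B u (s + Pi.single b₁ k₁ + Pi.single b₂ k₂) b = 0 := by
    rw [← Finset.sum_sub_distrib, ← Finset.sum_sub_distrib, ← Finset.sum_add_distrib]
    refine Finset.sum_eq_zero ?_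
    intro b _
    by_cases h1 : b = b₁
    · subst h1
      have e2 : (s + Pi.single b₂ k₂ : Ty B) b = s b := by
        rw [Pi.add_apply, Pi.single_eq_of_ne hb, add_zero]
      have e12 : (s + Pi.single b k₁ + Pi.single b₂ k₂ : Ty B) b = (s + Pi.single b k₁ : Ty B) b := by
        rw [Pi.add_apply, Pi.single_eq_of_ne hb, add_zero]
      rw [atomVec_congr B u e2, atomVec_congr B u e12]; abel
    · have e1 : (s + Pi.single b₁ k₁ : Ty B) b = s b := by
        rw [Pi.add_apply, Pi.single_eq_of_ne h1, add_zero]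
      have e12 : (s + Pi.single b₁ k₁ + Pi.single b₂ k₂ : Ty B) b = (s + Pi.single b₂ k₂ : Ty B) b := by
        simp only [Pi.add_apply, Pi.single_eq_of_ne h1, add_zero]
      rw [atomVec_congr B u e1, atomVec_congr B u e12]; abel
  have e : ∀ A1 A2 A3 A4 C : Ty B → ℤ, A1 - C - (A2 - C) - (A3 - C) + (A4 - C) = A1 - A2 - A3 + A4 := fun _ _ _ _ _ => by abel
  rw [e, hsum]

omit [AddGroup B] in
/-- **On an atom of regime `u` the affine form is the unit vector**: `affine u (u + k·δ_b) = e_{u + k·δ_b}`. [folklore] -/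
theorem affine_atom (u : ZMod 4) (b : B) (k : ZMod 4) : affine B u (atom B u b k) = Pi.single (atom B u b k) 1 := by
  unfold affine
  rw [← Finset.add_sum_erase _ _ (mem_univ b)]
  have hb : atomVec B u (atom B u b k) b = Pi.single (atom B u b k) 1 := by
    unfold atomVec
    congr 2
    rw [atom_apply, if_pos rfl, add_sub_cancel_left]
  have hrest : ∑ x ∈ univ.erase b, atomVec B u (atom B u b k) x = ((Fintype.card B : ℤ) - 1) • Pi.single (cst B u) 1 := by
    have hx : ∀ x ∈ univ.erase b, atomVec B u (atom B u b k) x = Pi.single (cst B u) 1 := by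
      intro x hx
      unfold atomVec
      rw [atom_apply, if_neg (ne_of_mem_erase hx), sub_self, atom_zero]
    rw [Finset.sum_congr rfl hx, Finset.sum_const, Finset.card_erase_of_mem (mem_univ b), Finset.card_univ]
    have h1 : 1 ≤ Fintype.card B := Fintype.card_pos_iff.mpr ⟨b⟩
    rw [← natCast_zsmul]
    congr 1
    omega
  rw [hb, hrest]; abel

omit [AddGroup B] in
/-- The potential of an atom relative to its own regime is `Lee k`. [folklore] -/
theorem L_atom_self (u : ZMod 4) (b : B) (k : ZMod 4) : L B u (atom B u b k) = lee k := by
  rw [L_eq_add_erase B u _ b, atom_apply, if_pos rfl, add_sub_cancel_left]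
  have h0 : ∑ x ∈ univ.erase b, lee (atom B u b k x - u) = 0 := by
    refine Finset.sum_eq_zero ?_
    intro x hx
    rw [atom_apply, if_neg (ne_of_mem_erase hx), sub_self]
    decide
  rw [h0, add_zero]

omit [AddGroup B] in
/-- The potential of an atom relative to another regime `u' ≠ u` is at least `|B| − 1` plus the Lee weight at the defect. [folklore] -/
theorem L_atom_other (u : ZMod 4) (b : B) (k u' : ZMod 4) :
    L B u' (atom B u b k) = lee (u + k - u') + (Fintype.card B - 1) * lee (u - u') := by
  rw [L_eq_add_erase B u' _ b, atom_apply, if_pos rfl]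
  have hrest : ∑ x ∈ univ.erase b, lee (atom B u b k x - u') = (Fintype.card B - 1) * lee (u - u') := by
    have hx : ∀ x ∈ univ.erase b, lee (atom B u b k x - u') = lee (u - u') := by
      intro x hx; rw [atom_apply, if_neg (ne_of_mem_erase hx)]
    rw [Finset.sum_congr rfl hx, Finset.sum_const, Finset.card_erase_of_mem (mem_univ b), Finset.card_univ, smul_eq_mul]
  rw [hrest]

omit [AddGroup B] in
/-- **Atoms have the expected regime** (`|B|` odd, `≥ 3`): `reg (u + k·δ_b) = u`. [folklore] -/
theorem reg_atom (hB : Odd (Fintype.card B)) (h3 : 3 ≤ Fintype.card B) (u : ZMod 4) (b : B) (k : ZMod 4) :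
    reg B (atom B u b k) = u := by
  symm
  refine eq_reg_of_L_eq B hB (le_antisymm ?_ (Phi_le B u _))
  obtain ⟨u', hu'⟩ := exists_L_eq_Phi B (atom B u b k)
  rw [← hu']
  by_cases h : u' = u
  · rw [h]
  · rw [L_atom_self, L_atom_other]
    have h1 : 1 ≤ lee (u - u') := by
      have hne : u - u' ≠ 0 := sub_ne_zero.mpr (Ne.symm h)
      have := (lee_eq_zero_iff (u - u')).not.mpr hne
      omega
    have h2 := lee_le_two k
    have h4 : 2 ≤ (Fintype.card B - 1) * lee (u - u') := by
      calc 2 ≤ (Fintype.card B - 1) * 1 := by omega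
        _ ≤ (Fintype.card B - 1) * lee (u - u') := Nat.mul_le_mul_left _ h1
    -- `lee k ≤ 2 ≤ (|B|−1)·lee(u−u')`, with equality excluded: if `lee k = 2` then `k = 2` and the defect term is `≥ 1` unless
    -- `u − u' = 2`, where the rest is `2(|B|−1) ≥ 4`
    by_cases hk : lee k ≤ 1
    · omega
    · have hk2 : k = 2 := by
        have key : ∀ k : ZMod 4, ¬ lee k ≤ 1 → k = 2 := by decide
        exact key k hk
      subst hk2
      have key : ∀ d : ZMod 4, d ≠ 0 → 1 ≤ lee (2 + d) ∨ lee d = 2 := by decide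
      rcases key (u - u') (sub_ne_zero.mpr (Ne.symm h)) with hd | hd
      · rw [show u + 2 - u' = 2 + (u - u') by ring]
        have : lee (2 : ZMod 4) = 2 := by decide
        omega
      · rw [hd] at h4 ⊢
        have : lee (2 : ZMod 4) = 2 := by decide
        omega

/-! ## §2 The affine reduction -/

/-- **A covering family.**  The submodule `N` contains, through every non-residual type `s`, the class of a cross square `(s; p, q)`
(`p`, `q` in different columns) whose three other corners have smaller Lee potential. [folklore] -/
def Covers (N : Submodule ℤ (Ty B → ℤ)) : Prop :=
  ∀ s : Ty B, ¬ IsRes B s → ∃ p q : ZMod 2 × B, p.2 ≠ q.2 ∧ faceVec B s p q ∈ N ∧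
    Phi B (flip B p s) < Phi B s ∧ Phi B (flip B q s) < Phi B s ∧ Phi B (flip B q (flip B p s)) < Phi B s

omit [AddGroup B] in
/-- A move that lowers the Lee weight at its column lowers `L u` by one. [folklore] -/
theorem L_move_toward (u : ZMod 4) (s : Ty B) (b : B) (e : ZMod 4) (h : lee (s b + e - u) + 1 = lee (s b - u)) :
    L B u (s + Pi.single b e) + 1 = L B u s := by
  have h1 := L_eq_add_erase B u (s + Pi.single b e : Ty B) b
  have h2 := L_eq_add_erase B u s b
  have hrest : ∑ x ∈ univ.erase b, lee ((s + Pi.single b e : Ty B) x - u) = ∑ x ∈ univ.erase b, lee (s x - u) := by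
    refine Finset.sum_congr rfl ?_
    intro x hx
    rw [Pi.add_apply, Pi.single_eq_of_ne (ne_of_mem_erase hx), add_zero]
  rw [hrest, Pi.add_apply, Pi.single_eq_same] at h1
  omega

omit [AddGroup B] in
/-- **THE AFFINE REDUCTION** (`|B|` odd, `≥ 3`).  If `N` covers, then `e_s − affine (reg s) s ∈ N` for every type `s`. [folklore] -/
theorem single_sub_affine_mem (hB : Odd (Fintype.card B)) (h3 : 3 ≤ Fintype.card B) {N : Submodule ℤ (Ty B → ℤ)}
    (hN : Covers B N) (s : Ty B) : Pi.single s 1 - affine B (reg B s) s ∈ N := by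
  induction hΦ : Phi B s using Nat.strong_induction_on generalizing s with
  | _ n ih =>
  by_cases hres : IsRes B s
  · obtain ⟨u, b, k, rfl⟩ := hres
    rw [reg_atom B hB h3, affine_atom, sub_self]
    exact Submodule.zero_mem _
  · obtain ⟨p, q, hpq, hface, h1, h2, h12⟩ := hN s hres
    obtain ⟨u, hu⟩ : ∃ u, reg B s = u := ⟨_, rfl⟩
    obtain ⟨e₁, he₁⟩ : ∃ e₁, step p.1 (s p.2) = e₁ := ⟨_, rfl⟩
    obtain ⟨e₂, he₂⟩ : ∃ e₂, step q.1 (s q.2) = e₂ := ⟨_, rfl⟩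
    have he₁' : e₁ = 1 ∨ e₁ = -1 := he₁ ▸ step_eq_or _ _
    have he₂' : e₂ = 1 ∨ e₂ = -1 := he₂ ▸ step_eq_or _ _
    -- the corners as moves (equations taken from the lemma statements)
    have hs₁ : flip B p s = s + Pi.single p.2 e₁ := by rw [flip_eq_add_single, he₁]
    have hs₂ : flip B q s = s + Pi.single q.2 e₂ := by rw [flip_eq_add_single, he₂]
    have hs₁₂ : flip B q (flip B p s) = s + Pi.single p.2 e₁ + Pi.single q.2 e₂ := by rw [flip_flip_of_ne B p q hpq s, he₁, he₂]
    have hs₁₂' : flip B q (flip B p s) = flip B p s + Pi.single q.2 e₂ := by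
      rw [flip_eq_add_single B q (flip B p s), flip_apply_of_ne B p s (Ne.symm hpq), he₂]
    -- regimes of the two single corners, and the Lee drop at `q.2`
    have hm₁ := reg_move B hB s p.2 e₁ he₁' (by rw [← hs₁]; exact h1)
    have hm₂ := reg_move B hB s q.2 e₂ he₂' (by rw [← hs₂]; exact h2)
    have hlee₂ := lee_move_of_Phi_lt B hB s q.2 e₂ he₂' (by rw [← hs₂]; exact h2)
    rw [hu] at hm₁ hm₂ hlee₂
    have hr₁ : reg B (flip B p s) = u := by rw [hs₁]; exact hm₁.1
    have hr₂ : reg B (flip B q s) = u := by rw [hs₂]; exact hm₂.1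
    -- the double corner: the second move lowers `Φ` from the first corner, so its regime is `u` too
    have hlee₂' : lee (flip B p s q.2 + e₂ - u) + 1 = lee (flip B p s q.2 - u) := by
      rw [flip_apply_of_ne B p s (Ne.symm hpq)]; exact hlee₂
    have hdrop := L_move_toward B u (flip B p s) q.2 e₂ hlee₂'
    have hL₁ : L B u (flip B p s) = Phi B (flip B p s) := by rw [← hr₁]; exact L_reg B _
    have hm₁₂ := reg_move B hB (flip B p s) q.2 e₂ he₂' (by
      have := Phi_le B u (flip B p s + Pi.single q.2 e₂)
      omega)
    have hr₁₂ : reg B (flip B q (flip B p s)) = u := by rw [hs₁₂']; exact hm₁₂.1.trans hr₁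
    -- induction hypothesis on the three corners
    have i₁ := ih _ (h1.trans_eq hΦ) (flip B p s) rfl
    have i₂ := ih _ (h2.trans_eq hΦ) (flip B q s) rfl
    have i₁₂ := ih _ (h12.trans_eq hΦ) (flip B q (flip B p s)) rfl
    rw [hr₁] at i₁
    rw [hr₂] at i₂
    rw [hr₁₂] at i₁₂
    -- additivity of the affine form, read on the corners
    have hadd := affine_square B u s hpq e₁ e₂
    rw [← hs₁₂, ← hs₁, ← hs₂] at hadd
    rw [hu]
    have key : Pi.single s 1 - affine B u s = faceVec B s p q + (Pi.single (flip B p s) 1 - affine B u (flip B p s))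
        + (Pi.single (flip B q s) 1 - affine B u (flip B q s))
        - (Pi.single (flip B q (flip B p s)) 1 - affine B u (flip B q (flip B p s)))
        - (affine B u s - affine B u (flip B p s) - affine B u (flip B q s) + affine B u (flip B q (flip B p s))) := by
      unfold faceVec; abel
    rw [key, hadd, sub_zero]
    exact Submodule.sub_mem _ (Submodule.add_mem _ (Submodule.add_mem _ hface i₁) i₂) i₁₂

/-! ## §3 Reduction to the small residual types -/

/-- The column faces at the constant types lie in `N`: `[u] − [u^{(0,b)}] − [u^{(1,b)}] + [u + 2δ_b] ∈ N` for all `u`, `b`. [folklore] -/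
def HasColumnFaces (N : Submodule ℤ (Ty B → ℤ)) : Prop := ∀ (u : ZMod 4) (b : B), faceVec B (cst B u) (0, b) (1, b) ∈ N

omit [AddGroup B] in
/-- The column face at a constant type, written in atoms: `e_u − e_{u+e·δ_b} − e_{u−e·δ_b} + e_{u+2δ_b}` with `e = step 0 u`. [folklore] -/
theorem faceVec_cst_column (u : ZMod 4) (b : B) :
    faceVec B (cst B u) (0, b) (1, b) = Pi.single (cst B u) 1 - Pi.single (atom B u b (step 0 u)) 1
      - Pi.single (atom B u b (-step 0 u)) 1 + Pi.single (atom B u b 2) 1 := by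
  unfold faceVec atom
  have h1 : flip B (0, b) (cst B u) = cst B u + Pi.single b (step 0 u) := flip_eq_add_single B _ _
  have h2 : flip B (1, b) (cst B u) = cst B u + Pi.single b (-step 0 u) := by
    rw [flip_eq_add_single, show (1 : ZMod 2) = 0 + 1 by decide, step_succ]; rfl
  have h3 : flip B (1, b) (flip B (0, b) (cst B u)) = cst B u + Pi.single b 2 := by
    rw [show ((1 : ZMod 2), b) = ((0 : ZMod 2) + 1, b) by rw [zero_add], flip_flip_same]
  rw [h3, h1, h2]

/-- The set of vectors congruent modulo `N` to a vector supported on the small residual types. [folklore] -/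
def Good (N : Submodule ℤ (Ty B → ℤ)) : Submodule ℤ (Ty B → ℤ) where
  carrier := {m | ∃ r : Ty B → ℤ, m - r ∈ N ∧ ∀ t, r t ≠ 0 → IsRes1 B t}
  zero_mem' := ⟨0, by rw [sub_zero]; exact Submodule.zero_mem _, fun t h => (h rfl).elim⟩
  add_mem' := by
    rintro m m' ⟨r, hr, hr'⟩ ⟨r₂, hr₂, hr₂'⟩
    refine ⟨r + r₂, ?_, ?_⟩
    · have : m + m' - (r + r₂) = (m - r) + (m' - r₂) := by abel
      rw [this]; exact Submodule.add_mem _ hr hr₂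
    · intro t ht
      rw [Pi.add_apply] at ht
      by_cases h : r t = 0
      · rw [h, zero_add] at ht; exact hr₂' t ht
      · exact hr' t h
  smul_mem' := by
    rintro c m ⟨r, hr, hr'⟩
    refine ⟨c • r, ?_, ?_⟩
    · rw [← smul_sub]; exact Submodule.smul_mem _ c hr
    · intro t ht
      rw [Pi.smul_apply, smul_eq_mul] at ht
      exact hr' t (fun h => ht (by rw [h, mul_zero]))

omit [AddGroup B] [Fintype B] in
/-- `N ≤ Good N`. [folklore] -/
theorem le_good (N : Submodule ℤ (Ty B → ℤ)) : N ≤ Good B N :=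
  fun m hm => ⟨0, by rw [sub_zero]; exact hm, fun t h => (h rfl).elim⟩

omit [AddGroup B] in
/-- A unit vector at a small residual type is good. [folklore] -/
theorem single_mem_good_of_isRes1 (N : Submodule ℤ (Ty B → ℤ)) {t : Ty B} (ht : IsRes1 B t) (c : ℤ) : Pi.single t c ∈ Good B N := by
  refine ⟨Pi.single t c, by rw [sub_self]; exact Submodule.zero_mem _, ?_⟩
  intro t' h
  rw [Pi.single_apply] at h
  by_cases htt : t' = t
  · rw [htt]; exact ht
  · rw [if_neg htt] at h; exact (h rfl).elim

omit [AddGroup B] in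
/-- **Unit vectors at ALL atoms are good** once `N` has the column faces at the constant types (the `2`-atom is
`e_{u+e δ} + e_{u−e δ} − e_u` plus a column face). [folklore] -/
theorem single_atom_mem_good {N : Submodule ℤ (Ty B → ℤ)} (hC : HasColumnFaces B N) (u : ZMod 4) (b : B) (k : ZMod 4) :
    Pi.single (atom B u b k) (1 : ℤ) ∈ Good B N := by
  have hstep : step 0 u = 1 ∨ step 0 u = -1 := step_eq_or 0 u
  have small : ∀ k : ZMod 4, (k = 0 ∨ k = 1 ∨ k = -1) → Pi.single (atom B u b k) (1 : ℤ) ∈ Good B N :=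
    fun k hk => single_mem_good_of_isRes1 B N ⟨u, b, k, hk, rfl⟩ 1
  have key : ∀ k : ZMod 4, (k = 0 ∨ k = 1 ∨ k = -1) ∨ k = 2 := by decide
  rcases key k with hk | rfl
  · exact small k hk
  · -- `e_{u + 2δ_b} = colface + e_{u+eδ} + e_{u−eδ} − e_u`
    have e : Pi.single (atom B u b 2) (1 : ℤ) = faceVec B (cst B u) (0, b) (1, b) + Pi.single (atom B u b (step 0 u)) 1
        + Pi.single (atom B u b (-step 0 u)) 1 - Pi.single (cst B u) 1 := by
      rw [faceVec_cst_column]; abel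
    rw [e]
    refine Submodule.sub_mem _ (Submodule.add_mem _ (Submodule.add_mem _ (le_good B N (hC u b)) (small _ ?_)) (small _ ?_)) ?_
    · rcases hstep with h | h <;> rw [h]
      · exact Or.inr (Or.inl rfl)
      · exact Or.inr (Or.inr rfl)
    · rcases hstep with h | h <;> rw [h]
      · exact Or.inr (Or.inr rfl)
      · exact Or.inr (Or.inl (by decide))
    · rw [← atom_zero B u b]
      exact small 0 (Or.inl rfl)

omit [AddGroup B] in
/-- **The affine form is good** (`b₀` any column, witnessing `B ≠ ∅`). [folklore] -/
theorem affine_mem_good {N : Submodule ℤ (Ty B → ℤ)} (hC : HasColumnFaces B N) (b₀ : B) (u : ZMod 4) (s : Ty B) :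
    affine B u s ∈ Good B N := by
  unfold affine atomVec
  refine Submodule.sub_mem _ (Submodule.sum_mem _ fun b _ => single_atom_mem_good B hC u b _) ?_
  refine Submodule.smul_mem _ _ ?_
  rw [← atom_zero B u b₀]
  exact single_atom_mem_good B hC u _ 0

omit [AddGroup B] in
/-- **THE REDUCTION TO SMALL RESIDUAL TYPES** (`|B|` odd, `≥ 3`).  If `N` covers and contains the column faces at the constant types,
every exponent vector is congruent modulo `N` to a vector supported on the types `u`, `u + δ_b`, `u − δ_b`. [folklore] -/
theorem exists_reduced (hB : Odd (Fintype.card B)) (h3 : 3 ≤ Fintype.card B) {N : Submodule ℤ (Ty B → ℤ)} (hN : Covers B N)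
    (hC : HasColumnFaces B N) (m : Ty B → ℤ) : ∃ r : Ty B → ℤ, m - r ∈ N ∧ ∀ t, r t ≠ 0 → IsRes1 B t := by
  suffices h : m ∈ Good B N from h
  have hm : m = ∑ s, m s • Pi.single s (1 : ℤ) := by
    conv_lhs => rw [← Finset.univ_sum_single m]
    refine Finset.sum_congr rfl ?_
    intro s _
    funext t
    rw [Pi.smul_apply, Pi.single_apply, Pi.single_apply, smul_eq_mul]
    split_ifs <;> simp
  rw [hm]
  refine Submodule.sum_mem _ fun s _ => Submodule.smul_mem _ _ ?_
  have e : Pi.single s (1 : ℤ) = (Pi.single s 1 - affine B (reg B s) s) + affine B (reg B s) s := by abel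
  rw [e]
  have hne : Nonempty B := Fintype.card_pos_iff.mp (by omega)
  exact Submodule.add_mem _ (le_good B N (single_sub_affine_mem B hB h3 hN s)) (affine_mem_good B hC hne.some _ s)

end Summit.HodgeConjecture.CorCM.Census.QuarticTwist
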